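import Literature.MathematicalPhysics.QuantumFieldTheory.Balaban1983to89.B1Eq324BenfattoClassTorusWindow
import Literature.MathematicalPhysics.QuantumFieldTheory.Balaban1983to89.B1Eq324BenfattoKernelEq324AnyGamma
import HarnessLib

/-!
# `Balaban1983to89.B1Eq324BenfattoClassTorusLaplacian` — THE CAPSTONE INSTANCE: [Balaban1982Higgs1] (3.24) for the MASSIVE FREE FIELD ON THE
# DISCRETE TORUS `(ℤ/N)^d` ([BenfattoEtAl1978]'s Basic Lemma setting, p. 144 «a massive free euclidean field on a unit lattice», moved from `ℤ^d` to
# a finite torus — the situation of [Balaban1985UV3] (22)/(58) at the trivial background and trivial history), UNCONDITIONAL, by the class road +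
# the bent window

statement-level companion of a published source with citation tags; every declaration here is a theorem; nothing here is
a claim about the Yang–Mills mass gap

WHY THIS MODULE (cell `pub-ymgap`, seat `dag-n08-b` gen 14, INTENT-5; node N08 [Balaban1985UV3]).  The class road of this cell (≈ 60 modules,
seats n08-b / n08-c / n08-d / n08-w5; output `…KernelEq324AnyGamma.eq324_kernel_of_expDecay`) and the bent window (`…ClassTorusWindow`) are
typed over hypotheses.  This file RUNS THEM END TO END on a concrete member with NO hypothesis left but the smallness of the interaction: the
precision `T = m² + (−Δ_T)` of the massive Gaussian free field on the discrete torus `(ℤ/N)^d` (`d ≥ 1`, every `N ≥ 1`, every mass² `m² > 0`) —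
symmetric, `m²`-coercive (the torus Dirichlet form `Σ_i Σ_x (v_x − v_{x+e_i})² ≥ 0`), of range `1` in the torus metric — presented on the labelled
bent window of `ℤ^{2d+1}`.  The result is a kernel-checked certificate that (i) the road composes (every `∃` of the chain is inhabited at a
non-degenerate member), and (ii) wrapped regions (CHECK C) are served.

WHAT IS PROVED (standard axioms; no `sorry`; no definition — the torus Laplacian is the displayed lambda
`T x y = (m² + 2d)·[x = y] − Σ_i ([y = x + e_i] + [y = x − e_i])`, `e_i = Pi.single i 1`).
* §1 `torusLaplacian_symm`, ★ `torusLaplacian_form_eq` (`Σ T v v = m²Σv² + Σ_iΣ_x(v_x − v_{x+e_i})²`), ★ `torusLaplacian_coercive`,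
  `abs_valMinAbs_single_le_one`, ★ `torusLaplacian_abs_le_exp` (`|T x y| ≤ (m² + 4d)·e·e^{−ρ_∞(x,y)}`, `ρ_∞` the torus sup-distance).
* §2 ★★★ `eq324_torusFreeField` — for `d ≥ 1`, `N ≥ 1`, `m² > 0`, every `t D`, `ϰ > 0`, `b₀ > 0`, `p₀ > 2/3`, `σ > 0`, `c ≥ 0`, `0 < κ < σ(t+1)`:
  there are a window `Λ ⊂ ℤ^{2d+1}`, a bijection `e : (ℤ/N)^d ≃ ↥Λ`, and `η₀ ∈ (0,1]`, `C ≥ 0` such that the class field `μ_K`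
  (`K` = zero-extended `(reindex e e T)⁻¹`) PRESENTS the torus free field (`(μ_K).map (z ↦ z ∘ e) = 𝒩(0, T⁻¹)`), its uniform-threshold boxes pull back
  to `smallFieldSet Λ p` a.e., and for all `η ≤ η₀` and every `(s, I ⊇ J, a)` with `I ≠ ∅`, `J ⊆ Λ`, `coefSup ≤ c·η^σ`:
  `0 < ∫Π_Δχ̂_{p(η)}e^{H_J}dμ_K ∧ |log ∫Π_Δχ̂_{p(η)}e^{H_J}dμ_K − cumulantSum μ_K H_J t| ≤ C·η^κ·|I|`.
HONEST SCOPE.  An INSTANCE of OUR class form at the simplest torus member (the free massive field; [Balaban1985UV3]'s fluctuation precision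
`C*Δ_kC` at a general background is N06's business); the interaction `H_J` is any (4.5)-Hamiltonian on the window — which (4.5)-Hamiltonian
presents [Balaban1985UV3]'s `𝒱` is the IDENT, NOT claimed; count-neutral for N08; nothing about d = 4, the continuum, OS axioms, a mass gap or
the Clay problem.
-/

noncomputable section

open MeasureTheory Finset Matrix
open scoped BigOperators

namespace Literature.MathematicalPhysics.QuantumFieldTheory.Balaban1983to89.B1Eq324BenfattoClassTorusLaplacian

open Literature.MathematicalPhysics.QuantumFieldTheory
open Literature.MathematicalPhysics.QuantumFieldTheory.Balaban1983to89.B1Eq324BenfattoLemma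
open Literature.MathematicalPhysics.QuantumFieldTheory.Balaban1983to89.B1Eq324BenfattoClassTorusWindow (exists_presentation_of_torusDecay)
open Literature.MathematicalPhysics.QuantumFieldTheory.Balaban1983to89.B1Eq324BenfattoKernelEq324AnyGamma (eq324_kernel_of_expDecay)

variable {d N : ℕ}

/-! ## §1  The massive torus Laplacian `T = m² + (−Δ_T)` on `(ℤ/N)^d` -/

section Laplacian

variable [NeZero N]

omit [NeZero N] in
/-- kernel: the neighbour indicator is symmetric — `y = x + e ↔ x = y − e` and `y = x − e ↔ x = y + e`. [folklore] -/
private theorem nbr_symm (x y e : Fin d → ZMod N) :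
    ((if y = x + e then (1 : ℝ) else 0) + (if y = x - e then 1 else 0)) =
      ((if x = y + e then (1 : ℝ) else 0) + (if x = y - e then 1 else 0)) := by
  have h1 : (y = x + e) ↔ (x = y - e) := by constructor <;> intro h <;> rw [h] <;> simp
  have h2 : (y = x - e) ↔ (x = y + e) := by constructor <;> intro h <;> rw [h] <;> simp
  simp only [h1, h2]
  ring

omit [NeZero N] in
/-- **`T` is symmetric.** [cite: BenfattoEtAl1978, (1.1) p.144 (torus form; ours)] -/
theorem torusLaplacian_symm (mass : ℝ) :
    ∀ x y : Fin d → ZMod N,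
      ((mass + 2 * d) * (if x = y then (1 : ℝ) else 0) -
          ∑ i : Fin d, ((if y = x + Pi.single i 1 then (1 : ℝ) else 0) + (if y = x - Pi.single i 1 then 1 else 0))) =
      ((mass + 2 * d) * (if y = x then (1 : ℝ) else 0) -
          ∑ i : Fin d, ((if x = y + Pi.single i 1 then (1 : ℝ) else 0) + (if x = y - Pi.single i 1 then 1 else 0))) := by
  intro x y
  have h0 : (if x = y then (1 : ℝ) else 0) = (if y = x then (1 : ℝ) else 0) := by
    by_cases h : x = y
    · rw [if_pos h, if_pos h.symm]
    · rw [if_neg h, if_neg (fun h' => h h'.symm)]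
  rw [h0, Finset.sum_congr rfl fun i _ => nbr_symm x y (Pi.single i 1)]

/-- ★ **THE TORUS DIRICHLET FORM**: `Σ_x Σ_y T x y v_x v_y = m²·Σ_x v_x² + Σ_i Σ_x (v_x − v_{x+e_i})²` (translation invariance of the torus sum:
`Σ_x v_x v_{x−e_i} = Σ_x v_{x+e_i} v_x`). [cite: BenfattoEtAl1978, (1.1) p.144 (torus form; ours)] -/
theorem torusLaplacian_form_eq (mass : ℝ) (v : (Fin d → ZMod N) → ℝ) :
    ∑ x : Fin d → ZMod N, ∑ y : Fin d → ZMod N,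
        ((mass + 2 * d) * (if x = y then (1 : ℝ) else 0) -
            ∑ i : Fin d, ((if y = x + Pi.single i 1 then (1 : ℝ) else 0) + (if y = x - Pi.single i 1 then 1 else 0))) * v x * v y =
      mass * ∑ x, v x ^ 2 + ∑ i : Fin d, ∑ x : Fin d → ZMod N, (v x - v (x + Pi.single i 1)) ^ 2 := by
  classical
  -- inner sums against the indicators
  have hdiag : ∀ x : Fin d → ZMod N, ∑ y, (if x = y then (1 : ℝ) else 0) * v x * v y = v x * v x := by
    intro x
    simp only [ite_mul, one_mul, zero_mul]
    rw [Finset.sum_ite_eq Finset.univ x (fun y => v x * v y)]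
    simp
  have hplus : ∀ (x e : Fin d → ZMod N), ∑ y, (if y = x + e then (1 : ℝ) else 0) * v x * v y = v x * v (x + e) := by
    intro x e
    simp only [ite_mul, one_mul, zero_mul]
    rw [Finset.sum_ite_eq' Finset.univ (x + e) (fun y => v x * v y)]
    simp
  have hminus : ∀ (x e : Fin d → ZMod N), ∑ y, (if y = x - e then (1 : ℝ) else 0) * v x * v y = v x * v (x - e) := by
    intro x e
    simp only [ite_mul, one_mul, zero_mul]
    rw [Finset.sum_ite_eq' Finset.univ (x - e) (fun y => v x * v y)]
    simp
  -- expand the left side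
  have hL : ∀ x : Fin d → ZMod N, ∑ y,
      ((mass + 2 * d) * (if x = y then (1 : ℝ) else 0) -
          ∑ i : Fin d, ((if y = x + Pi.single i 1 then (1 : ℝ) else 0) + (if y = x - Pi.single i 1 then 1 else 0))) * v x * v y =
      (mass + 2 * d) * (v x * v x) - ∑ i : Fin d, (v x * v (x + Pi.single i 1) + v x * v (x - Pi.single i 1)) := by
    intro x
    have hsplit : ∀ y, ((mass + 2 * d) * (if x = y then (1 : ℝ) else 0) -
          ∑ i : Fin d, ((if y = x + Pi.single i 1 then (1 : ℝ) else 0) + (if y = x - Pi.single i 1 then 1 else 0))) * v x * v y =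
        (mass + 2 * d) * ((if x = y then (1 : ℝ) else 0) * v x * v y) -
          ∑ i : Fin d, ((if y = x + Pi.single i 1 then (1 : ℝ) else 0) * v x * v y + (if y = x - Pi.single i 1 then (1 : ℝ) else 0) * v x * v y) := by
      intro y
      rw [sub_mul, sub_mul, Finset.sum_mul, Finset.sum_mul]
      congr 1
      · ring
      · exact Finset.sum_congr rfl fun i _ => by ring
    rw [Finset.sum_congr rfl fun y _ => hsplit y, Finset.sum_sub_distrib, ← Finset.mul_sum, hdiag, Finset.sum_comm]
    congr 1
    refine Finset.sum_congr rfl fun i _ => ?_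
    rw [Finset.sum_add_distrib, hplus, hminus]
  rw [Finset.sum_congr rfl fun x _ => hL x, Finset.sum_sub_distrib, ← Finset.mul_sum, Finset.sum_comm]
  -- translation invariance: `Σ_x v_x v_{x−e} = Σ_x v_{x+e} v_x`
  have hshift : ∀ e : Fin d → ZMod N, ∑ x : Fin d → ZMod N, v x * v (x - e) = ∑ x : Fin d → ZMod N, v (x + e) * v x := by
    intro e
    rw [← Equiv.sum_comp (Equiv.addRight e) (fun x => v x * v (x - e))]
    simp only [Equiv.coe_addRight, add_sub_cancel_right]
  have hsq : ∀ e : Fin d → ZMod N, ∑ x : Fin d → ZMod N, v (x + e) ^ 2 = ∑ x : Fin d → ZMod N, v x ^ 2 := fun e =>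
    Equiv.sum_comp (Equiv.addRight e) (fun x => v x ^ 2)
  have hi : ∀ i : Fin d, ∑ x : Fin d → ZMod N, (v x * v (x + Pi.single i 1) + v x * v (x - Pi.single i 1)) =
      2 * ∑ x : Fin d → ZMod N, v x ^ 2 - ∑ x : Fin d → ZMod N, (v x - v (x + Pi.single i 1)) ^ 2 := by
    intro i
    rw [Finset.sum_add_distrib, hshift (Pi.single i 1)]
    have hexp : ∑ x : Fin d → ZMod N, (v x - v (x + Pi.single i 1)) ^ 2 =
        ∑ x : Fin d → ZMod N, v x ^ 2 + ∑ x : Fin d → ZMod N, v (x + Pi.single i 1) ^ 2 - 2 * ∑ x : Fin d → ZMod N, v x * v (x + Pi.single i 1) := by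
      rw [← Finset.sum_add_distrib, Finset.mul_sum, ← Finset.sum_sub_distrib]
      exact Finset.sum_congr rfl fun x _ => by ring
    rw [hexp, hsq]
    have hcomm : ∑ x : Fin d → ZMod N, v (x + Pi.single i 1) * v x = ∑ x : Fin d → ZMod N, v x * v (x + Pi.single i 1) := Finset.sum_congr rfl fun x _ => mul_comm _ _
    rw [hcomm]
    ring
  rw [Finset.sum_congr rfl fun i _ => hi i, Finset.sum_sub_distrib, Finset.sum_const, Finset.card_univ, Fintype.card_fin, nsmul_eq_mul]
  have hx2 : ∑ x : Fin d → ZMod N, v x * v x = ∑ x : Fin d → ZMod N, v x ^ 2 := Finset.sum_congr rfl fun x _ => by ring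
  rw [hx2]
  ring

/-- ★ **`T` is `m²`-coercive** (the class road's coercivity row with `γ_A = m²`). [cite: BenfattoEtAl1978, (1.1) p.144; Balaban1985BackgroundPropagators, Sect. E p.428 «a lower bound γ₀ > 0» (torus free field; ours)] -/
theorem torusLaplacian_coercive (mass : ℝ) :
    ∀ v : (Fin d → ZMod N) → ℝ, mass * ∑ x, v x ^ 2 ≤ ∑ x : Fin d → ZMod N, ∑ y : Fin d → ZMod N,
        ((mass + 2 * d) * (if x = y then (1 : ℝ) else 0) -
            ∑ i : Fin d, ((if y = x + Pi.single i 1 then (1 : ℝ) else 0) + (if y = x - Pi.single i 1 then 1 else 0))) * v x * v y := by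
  intro v
  rw [torusLaplacian_form_eq]
  exact le_add_of_nonneg_right (Finset.sum_nonneg fun i _ => Finset.sum_nonneg fun x _ => sq_nonneg _)

/-- **A unit step on the torus has cyclic size `≤ 1` in every coordinate**: for `y = x ± e_i`, `|(x j − y j).valMinAbs| ≤ 1` for all `j`
(`(±1 : ℤ/N).valMinAbs ∈ {0, ±1}` by minimality). [folklore] [cite: Balaban1985UV3, (18) p.260 (the unit torus; bookkeeping ours)] -/
theorem abs_valMinAbs_single_le_one (x : Fin d → ZMod N) (i j : Fin d) (s : ℤ) (hs : |s| ≤ 1) :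
    |((x j - (x + (s : ZMod N) • (Pi.single i (1 : ZMod N) : Fin d → ZMod N)) j).valMinAbs : ℤ)| ≤ 1 := by
  have hval : x j - (x + (s : ZMod N) • (Pi.single i (1 : ZMod N) : Fin d → ZMod N)) j =
      -((s : ZMod N) * (Pi.single i (1 : ZMod N) : Fin d → ZMod N) j) := by
    simp only [Pi.add_apply, Pi.smul_apply, smul_eq_mul]
    ring
  rw [hval]
  by_cases hj : j = i
  · subst hj
    rw [Pi.single_eq_same, mul_one]
    have hmin := ZMod.natAbs_min_of_le_div_two N ((-(s : ZMod N)).valMinAbs) (-s)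
      (by rw [ZMod.coe_valMinAbs, Int.cast_neg]) (ZMod.natAbs_valMinAbs_le _)
    have h1 : ((-(s : ZMod N)).valMinAbs.natAbs : ℤ) ≤ ((-s).natAbs : ℤ) := by exact_mod_cast hmin
    rw [Int.natCast_natAbs, Int.natCast_natAbs, abs_neg] at h1
    exact h1.trans hs
  · rw [Pi.single_eq_of_ne hj, mul_zero, neg_zero, ZMod.valMinAbs_zero]
    simp

/-- ★ **`T` has range `1` in the torus metric**: for `d ≥ 1` and `m² ≥ 0`, `|T x y| ≤ (m² + 4d)·e·e^{−ρ_∞(x,y)}` with `ρ_∞(x,y) = max_i |(x i − y i).valMinAbs|`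
(the entry vanishes unless `ρ_∞ ≤ 1`). [cite: BenfattoEtAl1978, (1.1) p.144 (nearest-neighbour covariance); Balaban1985BackgroundPropagators, Sect. E p.428 (decay row; torus form ours)] -/
theorem torusLaplacian_abs_le_exp (hd : 0 < d) {mass : ℝ} (hmass : 0 ≤ mass) (x y : Fin d → ZMod N) :
    |((mass + 2 * d) * (if x = y then (1 : ℝ) else 0) -
        ∑ i : Fin d, ((if y = x + Pi.single i 1 then (1 : ℝ) else 0) + (if y = x - Pi.single i 1 then 1 else 0)))| ≤
      (mass + 4 * d) * Real.exp 1 * Real.exp (-(1 * ((Finset.univ.sup' ⟨⟨0, hd⟩, Finset.mem_univ _⟩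
        fun i => |((x i - y i).valMinAbs : ℤ)| : ℤ) : ℝ))) := by
  set ρ : ℤ := Finset.univ.sup' ⟨⟨0, hd⟩, Finset.mem_univ _⟩ fun i => |((x i - y i).valMinAbs : ℤ)| with hρ
  have hρ0 : 0 ≤ ρ := (abs_nonneg _).trans (Finset.le_sup' (fun i => |((x i - y i).valMinAbs : ℤ)|) (Finset.mem_univ ⟨0, hd⟩))
  -- the crude size bound
  have hsize : |((mass + 2 * d) * (if x = y then (1 : ℝ) else 0) -
      ∑ i : Fin d, ((if y = x + Pi.single i 1 then (1 : ℝ) else 0) + (if y = x - Pi.single i 1 then 1 else 0)))| ≤ mass + 4 * d := by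
    refine (abs_sub _ _).trans ?_
    have h1 : |(mass + 2 * d) * (if x = y then (1 : ℝ) else 0)| ≤ mass + 2 * d := by
      rw [abs_mul, abs_of_nonneg (by positivity : (0 : ℝ) ≤ mass + 2 * d)]
      refine mul_le_of_le_one_right (by positivity) ?_
      split_ifs <;> simp
    have h2 : |∑ i : Fin d, ((if y = x + Pi.single i 1 then (1 : ℝ) else 0) + (if y = x - Pi.single i 1 then 1 else 0))| ≤ 2 * d := by
      refine (Finset.abs_sum_le_sum_abs _ _).trans ?_
      have : ∀ i ∈ (Finset.univ : Finset (Fin d)),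
          |((if y = x + Pi.single i 1 then (1 : ℝ) else 0) + (if y = x - Pi.single i 1 then 1 else 0))| ≤ 2 := by
        intro i _
        rw [abs_le]
        constructor <;> split_ifs <;> norm_num
      refine (Finset.sum_le_sum this).trans ?_
      rw [Finset.sum_const, Finset.card_univ, Fintype.card_fin, nsmul_eq_mul, mul_comm]
    linarith
  by_cases hnear : ρ ≤ 1
  · -- `e · e^{−ρ} ≥ 1`
    have hρ1 : (ρ : ℝ) ≤ 1 := by exact_mod_cast hnear
    have hexp : (1 : ℝ) ≤ Real.exp 1 * Real.exp (-(1 * (ρ : ℝ))) := by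
      rw [← Real.exp_add]
      exact Real.one_le_exp (by linarith)
    calc _ ≤ mass + 4 * d := hsize
      _ ≤ (mass + 4 * d) * (Real.exp 1 * Real.exp (-(1 * (ρ : ℝ)))) := le_mul_of_one_le_right (by positivity) hexp
      _ = _ := by ring
  · -- far apart: the entry vanishes
    have hfar : 1 < ρ := not_le.mp hnear
    have hxy : x ≠ y := by
      intro h
      have : ρ = 0 := by
        refine le_antisymm ?_ hρ0
        refine Finset.sup'_le _ _ fun i _ => ?_
        rw [h, sub_self, ZMod.valMinAbs_zero]; simp
      omega
    have hstep : ∀ (i : Fin d) (s : ℤ), |s| ≤ 1 → y ≠ x + (s : ZMod N) • (Pi.single i (1 : ZMod N) : Fin d → ZMod N) := by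
      intro i s hs h
      have hle : ρ ≤ 1 := Finset.sup'_le _ _ fun j _ => by
        rw [h]; exact abs_valMinAbs_single_le_one x i j s hs
      omega
    have hzero : ((mass + 2 * d) * (if x = y then (1 : ℝ) else 0) -
        ∑ i : Fin d, ((if y = x + Pi.single i 1 then (1 : ℝ) else 0) + (if y = x - Pi.single i 1 then 1 else 0))) = 0 := by
      rw [if_neg hxy, mul_zero, zero_sub, neg_eq_zero]
      refine Finset.sum_eq_zero fun i _ => ?_
      have hp : y ≠ x + Pi.single i 1 := by
        have := hstep i 1 (by norm_num)
        simpa only [Int.cast_one, one_smul] using this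
      have hm : y ≠ x - Pi.single i 1 := by
        have := hstep i (-1) (by norm_num)
        simpa only [Int.cast_neg, Int.cast_one, neg_smul, one_smul, ← sub_eq_add_neg] using this
      rw [if_neg hp, if_neg hm, add_zero]
    rw [hzero, abs_zero]
    positivity

end Laplacian


/-! ## §2  [Balaban1982Higgs1] (3.24) for the massive free field on the discrete torus — end to end -/

/-- ★★★ **(3.24) FOR THE MASSIVE GAUSSIAN FREE FIELD ON THE DISCRETE TORUS `(ℤ/N)^d`, UNCONDITIONAL** — for `d ≥ 1`, `N ≥ 1`, mass² `m² > 0`, every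
truncation order `t`, degree `D`, `ϰ > 0`, threshold constants `b₀ > 0`, `p₀ > 2/3`, coupling power `σ > 0`, `c ≥ 0` and exponent `0 < κ < σ(t+1)`:
there are a window `Λ ⊂ ℤ^{2d+1}`, a bijection `e : (ℤ/N)^d ≃ ↥Λ` and `η₀ ∈ (0,1]`, `C ≥ 0` such that, with `K` the zero-extended inverse of the
re-indexed torus precision `reindex e e (m² + (−Δ_T))` and `μ_K` the class road's Gaussian field on `ℤ^{2d+1} → ℝ`:
(i) `μ_K` PRESENTS the torus free field: `(μ_K).map (z ↦ z ∘ e) = 𝒩(0, (m² − Δ_T)⁻¹)` on `(ℤ/N)^d → ℝ`;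
(ii) the uniform-threshold boxes `{∀ x, |ω x| ≤ p}` pull back to `smallFieldSet Λ p` up to a `μ_K`-null set (`p ≥ 0`);
(iii) for all `η ≤ η₀` and every `(s, I, J, a)` with `I ≠ ∅`, `J ⊆ I`, `J ⊆ Λ`, `coefSup ≤ c·η^σ`:
`0 < ∫Π_Δχ̂^I_{p(η)}e^{H^a_J}dμ_K` and `|log ∫Π_Δχ̂^I_{p(η)}e^{H^a_J}dμ_K − Σ_{k≤t}Ê^T_{μ_K}(H^a_J;k)/k!| ≤ C·η^κ·|I|`.
Proof: §1 (symmetric, `m²`-coercive, range 1 in the torus metric) ⇒ `…ClassTorusWindow.exists_presentation_of_torusDecay` (labelled bent window,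
one label) ⇒ `…KernelEq324AnyGamma.eq324_kernel_of_expDecay` on `ℤ^{2d+1}` with `(γ_A, K_A, κ_A) = (m², (m²+4d)e², 1/√(2d+1))`.
[cite: Balaban1982Higgs1, (3.24) p.616; BenfattoEtAl1978, Lemma (4.5)–(4.7) p.152 and §1 p.144 (on `ℤ^d`; the torus edition is ours);
Balaban1985UV3, (22) p.261, (58) p.270 (the unit torus); Balaban1985BackgroundPropagators, Sect. E p.428 (class form; ours)] -/
theorem eq324_torusFreeField [NeZero N] (hd : 0 < d) {mass : ℝ} (hmass : 0 < mass)
    (t D : ℕ) {ϰ : ℝ} (hϰ : 0 < ϰ) {b₀ p₀ σ c κ : ℝ} (hb₀ : 0 < b₀) (hp₀ : 2 / 3 < p₀) (hσ : 0 < σ) (hc : 0 ≤ c) (hκ : 0 < κ)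
    (hκσ : κ < σ * (t + 1)) :
    ∃ (Λ : Finset (B1Eq324BenfattoLemma.Site (d + d + 1))) (e : (Fin d → ZMod N) ≃ ↥Λ) (η₀ C : ℝ), 0 < η₀ ∧ η₀ ≤ 1 ∧ 0 ≤ C ∧
      ((gaussianFieldOfKernel fun x y => if h : x ∈ Λ ∧ y ∈ Λ then
          ((Matrix.reindex e e (Matrix.of fun x y : Fin d → ZMod N =>
            (mass + 2 * d) * (if x = y then (1 : ℝ) else 0) -
              ∑ i : Fin d, ((if y = x + Pi.single i 1 then (1 : ℝ) else 0) + (if y = x - Pi.single i 1 then 1 else 0))))⁻¹ :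
            Matrix ↥Λ ↥Λ ℝ) ⟨x, h.1⟩ ⟨y, h.2⟩ else 0).map
          (fun (z : B1Eq324BenfattoLemma.Site (d + d + 1) → ℝ) (x : Fin d → ZMod N) => z ((e x : ↥Λ) : B1Eq324BenfattoLemma.Site (d + d + 1))) =
        gaussianFieldOfKernel fun x y => ((Matrix.of fun x y : Fin d → ZMod N =>
            (mass + 2 * d) * (if x = y then (1 : ℝ) else 0) -
              ∑ i : Fin d, ((if y = x + Pi.single i 1 then (1 : ℝ) else 0) + (if y = x - Pi.single i 1 then 1 else 0)))⁻¹ :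
            Matrix (Fin d → ZMod N) (Fin d → ZMod N) ℝ) x y) ∧
      (∀ p : ℝ, 0 ≤ p →
        ((fun (z : B1Eq324BenfattoLemma.Site (d + d + 1) → ℝ) (x : Fin d → ZMod N) => z ((e x : ↥Λ) : B1Eq324BenfattoLemma.Site (d + d + 1))) ⁻¹'
            {ω : (Fin d → ZMod N) → ℝ | ∀ x, |ω x| ≤ p}) =ᵐ[gaussianFieldOfKernel fun x y => if h : x ∈ Λ ∧ y ∈ Λ then
          ((Matrix.reindex e e (Matrix.of fun x y : Fin d → ZMod N =>
            (mass + 2 * d) * (if x = y then (1 : ℝ) else 0) -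
              ∑ i : Fin d, ((if y = x + Pi.single i 1 then (1 : ℝ) else 0) + (if y = x - Pi.single i 1 then 1 else 0))))⁻¹ :
            Matrix ↥Λ ↥Λ ℝ) ⟨x, h.1⟩ ⟨y, h.2⟩ else 0] smallFieldSet Λ p) ∧
      ∀ η : ℝ, 0 < η → η ≤ η₀ →
        ∀ (s : ℕ) (I J : Finset (B1Eq324BenfattoLemma.Site (d + d + 1))) (a : Coef (d + d + 1)), I.Nonempty → J ⊆ I → J ⊆ Λ →
          coefSup s D a J ≤ c * η ^ σ →
          0 < ∫ z, cutoffBoltzmann (hamiltonian s D ϰ a J) I (B10.pFun b₀ p₀ η) z ∂(gaussianFieldOfKernel fun x y => if h : x ∈ Λ ∧ y ∈ Λ then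
              ((Matrix.reindex e e (Matrix.of fun x y : Fin d → ZMod N =>
                (mass + 2 * d) * (if x = y then (1 : ℝ) else 0) -
                  ∑ i : Fin d, ((if y = x + Pi.single i 1 then (1 : ℝ) else 0) + (if y = x - Pi.single i 1 then 1 else 0))))⁻¹ :
                Matrix ↥Λ ↥Λ ℝ) ⟨x, h.1⟩ ⟨y, h.2⟩ else 0) ∧
            |Real.log (∫ z, cutoffBoltzmann (hamiltonian s D ϰ a J) I (B10.pFun b₀ p₀ η) z ∂(gaussianFieldOfKernel fun x y =>
                if h : x ∈ Λ ∧ y ∈ Λ then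
                  ((Matrix.reindex e e (Matrix.of fun x y : Fin d → ZMod N =>
                    (mass + 2 * d) * (if x = y then (1 : ℝ) else 0) -
                      ∑ i : Fin d, ((if y = x + Pi.single i 1 then (1 : ℝ) else 0) + (if y = x - Pi.single i 1 then 1 else 0))))⁻¹ :
                    Matrix ↥Λ ↥Λ ℝ) ⟨x, h.1⟩ ⟨y, h.2⟩ else 0)) -
              cumulantSum (gaussianFieldOfKernel fun x y => if h : x ∈ Λ ∧ y ∈ Λ then
                ((Matrix.reindex e e (Matrix.of fun x y : Fin d → ZMod N =>
                  (mass + 2 * d) * (if x = y then (1 : ℝ) else 0) -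
                    ∑ i : Fin d, ((if y = x + Pi.single i 1 then (1 : ℝ) else 0) + (if y = x - Pi.single i 1 then 1 else 0))))⁻¹ :
                  Matrix ↥Λ ↥Λ ℝ) ⟨x, h.1⟩ ⟨y, h.2⟩ else 0)
                (hamiltonian s D ϰ a J) t| ≤ C * η ^ κ * I.card := by
  classical
  -- the member data of §1 through `Matrix.of`
  set T : Matrix (Fin d → ZMod N) (Fin d → ZMod N) ℝ := Matrix.of fun x y : Fin d → ZMod N =>
    (mass + 2 * d) * (if x = y then (1 : ℝ) else 0) -
      ∑ i : Fin d, ((if y = x + Pi.single i 1 then (1 : ℝ) else 0) + (if y = x - Pi.single i 1 then 1 else 0)) with hT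
  have hTs : ∀ b b', T b b' = T b' b := fun b b' => by
    simp only [hT, Matrix.of_apply]
    exact torusLaplacian_symm mass b b'
  have hγ : ∀ v : (Fin d → ZMod N) → ℝ, mass * ∑ b, v b ^ 2 ≤ ∑ b, ∑ b', T b b' * v b * v b' := fun v => by
    simp only [hT, Matrix.of_apply]
    exact torusLaplacian_coercive mass v
  have hK0 : 0 ≤ (mass + 4 * d) * Real.exp 1 := by positivity
  have hdec : ∀ b b' : Fin d → ZMod N, |T b b'| ≤ (mass + 4 * d) * Real.exp 1 *
      Real.exp (-(1 * ((Finset.univ.sup' ⟨⟨0, hd⟩, Finset.mem_univ _⟩ fun i => |((b i - b' i).valMinAbs : ℤ)| : ℤ) : ℝ))) := fun b b' => by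
    simp only [hT, Matrix.of_apply]
    exact torusLaplacian_abs_le_exp hd hmass.le b b'
  have hρ : ∀ (b b' : Fin d → ZMod N) (i : Fin d), (|((b i - b' i).valMinAbs : ℤ)| : ℝ) ≤
      ((Finset.univ.sup' ⟨⟨0, hd⟩, Finset.mem_univ _⟩ fun i => |((b i - b' i).valMinAbs : ℤ)| : ℤ) : ℝ) := fun b b' i => by
    exact_mod_cast Finset.le_sup' (fun i => |((b i - b' i).valMinAbs : ℤ)|) (Finset.mem_univ i)
  have hinj : Function.Injective fun b : Fin d → ZMod N => (b, (0 : Fin 1)) := fun a b h => (Prod.mk.inj h).1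
  obtain ⟨Λ, e, hsymm, hcoer, hdec', hmap, hbox⟩ :=
    exists_presentation_of_torusDecay d N 1 hd (fun b => b) (fun _ => (0 : Fin 1)) hinj hTs hmass hγ hK0 zero_le_one hdec hρ
  -- the class road on `ℤ^{2d+1}`
  have hd' : 0 < d + d + 1 := by omega
  have hKA : 0 ≤ (mass + 4 * d) * Real.exp 1 * Real.exp (1 * (1 : ℕ)) := by positivity
  have hκA : 0 < 1 / Real.sqrt (d + d + 1) := by positivity
  obtain ⟨η₀, C, hη₀, hη₀1, hC, hE⟩ :=
    eq324_kernel_of_expDecay (d := d + d + 1) hd' hmass hKA hκA t D hϰ hb₀ hp₀ hσ hc hκ hκσ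
  refine ⟨Λ, e, η₀, C, hη₀, hη₀1, hC, hmap, hbox, fun η hη hηle s I J a hI hJI hJΛ hA => ?_⟩
  have hΛ : Λ.Nonempty := ⟨_, (e fun _ => 0).2⟩
  have hdec'' : ∀ x y : ↥Λ, |(Matrix.reindex e e T) x y| ≤ (mass + 4 * d) * Real.exp 1 * Real.exp (1 * (1 : ℕ)) *
      Real.exp (-(1 / Real.sqrt (d + d + 1) *
        Real.sqrt (∑ j, ((((x : B1Eq324BenfattoLemma.Site (d + d + 1)) j : ℝ) - ((y : B1Eq324BenfattoLemma.Site (d + d + 1)) j : ℝ))) ^ 2))) := by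
    intro x y
    have h := hdec' x y
    push_cast at h ⊢
    exact h
  exact hE η hη hηle (fun x y => rfl) hΛ hsymm hcoer hdec'' s I J a hI hJI hJΛ hA

end Literature.MathematicalPhysics.QuantumFieldTheory.Balaban1983to89.B1Eq324BenfattoClassTorusLaplacian
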